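import Literature.Computability.QuantumComplexity.ZWRing
import HarnessLib

/-!
# `ℤ[ω]` in coordinates: the Galois conjugate `ω ↦ ω⁵ = -ω` and the size of coordinates

Topic `Literature/Computability/QuantumComplexity`, continuing `StateVectorDP.lean` / `ZWRing.lean`
(`ZW = Fin 4 → ℤ`, `zwVal`, `ZW.mul`, `ZW.cconj`, `zwVal_injective`). A classical machine that
stores elements of `ℤ[ω]` by coordinates needs an a-priori bound on the *coordinates* of the numbers
a simulation produces, whereas the analysis bounds their complex *values* (`|⟨x|ρ|y⟩| ≤ 1`, norms of
unit vectors). A bounded value alone does not bound coordinates (`(√2 - 1)ⁿ → 0` has coordinates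
`~(√2 + 1)ⁿ/2`); what does is a bound on the value **and** on its Galois conjugate under
`σ : √2 ↦ -√2` (`ω ↦ ω⁵ = -ω`, `i` fixed) — the conjugate circuit semantics `prodZeta ω⁵` of
`CliffordTPathSums.lean` exists for exactly this purpose (there: bounding the irrational part of an
acceptance probability). This file provides:

* `ZW.evalZeta ζ z = Σ zₖ ζᵏ`, with `zwVal = evalZeta ω` (`zwVal_eq_evalZeta`), additivity
  (`evalZetaHom`, `evalZeta_sum`, `evalZeta_zsmul`), multiplicativity for `ζ⁴ = -1` (`evalZeta_mul`),
  compatibility with `cconj` when moreover `conj ζ = -ζ³` (`evalZeta_cconj`), `evalZeta_one`,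
  `evalZeta_mulOmegaPow_one`;
* the conjugate (`ω⁵ = -ω` is `omega_pow_five` of `ControlledHadamard.lean`): `omega5_pow_four`,
  `conj_omega5`, `ZW.galConj z = (z₀, -z₁, z₂, -z₃)` with
  `evalZeta_omega5 : evalZeta ω⁵ z = zwVal (galConj z)`;
* **`ZW.natAbs_le_of_norm_le`**: if `‖zwVal z‖ ≤ M` and `‖evalZeta ω⁵ z‖ ≤ M` then every coordinate
  has `|zₖ| ≤ 2M` (from `z₀ = (Re v + Re v')/2`, `z₂ = (Im v + Im v')/2`,
  `z₁ ∓ z₃ = (Re v - Re v')/√2, (Im v - Im v')/√2`).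

## References

* L. M. Adleman, J. DeMarrais, M.-D. A. Huang, *Quantum computability*, SIAM J. Comput. 26 (1997),
  §6 (amplitudes in a number field handled coordinatewise; cf. the conjugate trick of
  `CliffordTPathSums.lean`).
* R. Jozsa, N. Linden, *On the role of entanglement in quantum-computational speed-up*, Proc. R.
  Soc. Lond. A 459 (2003), §3, lemma `ratlemma` ("the number of digits … grows at most linearly
  with the number of operations") — the role this bound plays for the `p`-blocked simulation.
-/

noncomputable section

namespace Literature.Computability.QuantumComplexity

open _root_.Computability Complexity Cryptography

/-! ### The conjugate root `ω⁵ = -ω` -/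

/-- `(ω⁵)⁴ = -1`. [folklore] -/
theorem omega5_pow_four : (omega ^ 5) ^ 4 = -1 := by
  rw [show (4 : ℕ) = 2 * 2 from rfl, pow_mul, omega5_pow_two, Complex.I_sq]

/-- `conj (ω⁵) = -(ω⁵)³`. [folklore] -/
theorem conj_omega5 : starRingEnd ℂ (omega ^ 5) = -(omega ^ 5) ^ 3 := by
  rw [map_pow, conj_omega]
  ring

namespace ZW

/-! ### Evaluation at a root `ζ` -/

/-- Evaluation of the coordinates at `ζ`: `Σ zₖ ζᵏ` (`ζ = ω` gives `zwVal`, `ζ = ω⁵` its Galois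
conjugate). [folklore] -/
def evalZeta (ζ : ℂ) (z : ZW) : ℂ := ∑ i : Fin 4, (z i : ℂ) * ζ ^ (i : ℕ)

/-- `evalZeta` spelled out. [folklore] -/
theorem evalZeta_eq (ζ : ℂ) (z : ZW) : evalZeta ζ z = z 0 + z 1 * ζ + z 2 * ζ ^ 2 + z 3 * ζ ^ 3 := by
  simp [evalZeta, Fin.sum_univ_four]

/-- `zwVal` is evaluation at `ω`. [folklore] -/
theorem zwVal_eq_evalZeta (z : ZW) : zwVal z = evalZeta omega z := rfl

/-- Evaluation is additive. [folklore] -/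
theorem evalZeta_add (ζ : ℂ) (z w : ZW) : evalZeta ζ (z + w) = evalZeta ζ z + evalZeta ζ w := by
  simp [evalZeta, Finset.sum_add_distrib, add_mul]

/-- Evaluation of zero. [folklore] -/
@[simp] theorem evalZeta_zero (ζ : ℂ) : evalZeta ζ 0 = 0 := by
  simp [evalZeta]

/-- Evaluation as an additive monoid homomorphism. [folklore] -/
def evalZetaHom (ζ : ℂ) : ZW →+ ℂ where
  toFun := evalZeta ζ
  map_zero' := evalZeta_zero ζ
  map_add' := evalZeta_add ζ

/-- `evalZetaHom` is `evalZeta` (definitional). [folklore] -/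
@[simp] theorem evalZetaHom_apply (ζ : ℂ) (z : ZW) : evalZetaHom ζ z = evalZeta ζ z := rfl

/-- Evaluation of a finite sum. [folklore] -/
theorem evalZeta_sum (ζ : ℂ) {ι : Type*} (s : Finset ι) (f : ι → ZW) :
    evalZeta ζ (∑ i ∈ s, f i) = ∑ i ∈ s, evalZeta ζ (f i) :=
  map_sum (evalZetaHom ζ) f s

/-- Evaluation of an integer multiple. [folklore] -/
theorem evalZeta_zsmul (ζ : ℂ) (n : ℤ) (z : ZW) : evalZeta ζ (n • z) = n * evalZeta ζ z := by
  rw [← evalZetaHom_apply, map_zsmul, evalZetaHom_apply, zsmul_eq_mul]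

/-- Evaluation of the unit. [folklore] -/
@[simp] theorem evalZeta_one (ζ : ℂ) : evalZeta ζ one = 1 := by
  simp [evalZeta_eq, one]

/-- **Evaluation is multiplicative at a root of `X⁴ + 1`.** [folklore] -/
theorem evalZeta_mul {ζ : ℂ} (h4 : ζ ^ 4 = -1) (z w : ZW) : evalZeta ζ (mul z w) = evalZeta ζ z * evalZeta ζ w := by
  simp only [evalZeta_eq, mul, Matrix.cons_val_zero, Matrix.cons_val_one, Matrix.cons_val]
  push_cast
  linear_combination (-((z 1 * w 3 + z 2 * w 2 + z 3 * w 1 : ℂ) + (z 2 * w 3 + z 3 * w 2) * ζ +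
    z 3 * w 3 * ζ ^ 2)) * h4

/-- `mulOmega` is multiplication by `ζ` at a root of `X⁴ + 1`. [folklore] -/
theorem evalZeta_mulOmega {ζ : ℂ} (h4 : ζ ^ 4 = -1) (z : ZW) : evalZeta ζ (mulOmega z) = ζ * evalZeta ζ z := by
  simp only [evalZeta_eq, mulOmega, Matrix.cons_val_zero, Matrix.cons_val_one, Matrix.cons_val, Int.cast_neg]
  linear_combination (-(z 3 : ℂ)) * h4

/-- `mulOmegaPow k one` evaluates to `ζ^k` at a root of `X⁴ + 1`. [folklore] -/
theorem evalZeta_mulOmegaPow_one {ζ : ℂ} (h4 : ζ ^ 4 = -1) (k : ℕ) : evalZeta ζ (mulOmegaPow k one) = ζ ^ k := by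
  induction k with
  | zero => simp [mulOmegaPow]
  | succ k ih =>
    rw [mulOmegaPow, Function.iterate_succ_apply', evalZeta_mulOmega h4, ← mulOmegaPow, ih, pow_succ, mul_comm]

/-- **Evaluation commutes with conjugation** at `ζ` with `ζ⁴ = -1` and `conj ζ = -ζ³` (both `ω` and
`ω⁵`). [folklore] -/
theorem evalZeta_cconj {ζ : ℂ} (h4 : ζ ^ 4 = -1) (hc : starRingEnd ℂ ζ = -ζ ^ 3) (z : ZW) :
    evalZeta ζ (cconj z) = starRingEnd ℂ (evalZeta ζ z) := by
  simp only [evalZeta_eq, cconj, Matrix.cons_val_zero, Matrix.cons_val_one, Matrix.cons_val, map_add,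
    map_mul, map_pow, map_intCast, hc]
  push_cast
  linear_combination ((z 3 : ℂ) * ζ ^ 5 - z 3 * ζ - z 2 * ζ ^ 2) * h4

/-! ### The Galois conjugate in coordinates -/

/-- The Galois conjugate `σ : ω ↦ -ω` (`√2 ↦ -√2`, `i` fixed) on coordinates: `(z₀, -z₁, z₂, -z₃)`.
[folklore] -/
def galConj (z : ZW) : ZW := ![z 0, -z 1, z 2, -z 3]

/-- **Evaluation at `ω⁵ = -ω` is the value of the Galois conjugate.** [folklore] -/
theorem evalZeta_omega5 (z : ZW) : evalZeta (omega ^ 5) z = zwVal (galConj z) := by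
  rw [omega_pow_five, zwVal_eq_evalZeta]
  simp only [evalZeta_eq, galConj, Matrix.cons_val_zero, Matrix.cons_val_one, Matrix.cons_val, Int.cast_neg]
  ring

/-- Real part of the conjugate value: `z₀ - (z₁ - z₃) √2/2`. [folklore] -/
theorem evalZeta_omega5_re (z : ZW) : (evalZeta (omega ^ 5) z).re = z 0 - (z 1 - z 3) * (Real.sqrt 2 / 2) := by
  rw [evalZeta_omega5, zwVal_re]
  simp [galConj]
  ring

/-- Imaginary part of the conjugate value: `z₂ - (z₁ + z₃) √2/2`. [folklore] -/
theorem evalZeta_omega5_im (z : ZW) : (evalZeta (omega ^ 5) z).im = z 2 - (z 1 + z 3) * (Real.sqrt 2 / 2) := by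
  rw [evalZeta_omega5, zwVal_im]
  simp [galConj]
  ring

/-! ### Bounding coordinates by the value and its conjugate -/

/-- **Coordinates are bounded by the value and its Galois conjugate**: if `‖zwVal z‖ ≤ M` and
`‖evalZeta ω⁵ z‖ ≤ M` then `|zₖ| ≤ 2M` for every coordinate. [folklore] -/
theorem abs_le_of_norm_le {z : ZW} {M : ℝ} (h1 : ‖zwVal z‖ ≤ M) (h2 : ‖evalZeta (omega ^ 5) z‖ ≤ M)
    (k : Fin 4) : |(z k : ℝ)| ≤ 2 * M := by
  have hre1 := (Complex.abs_re_le_norm (zwVal z)).trans h1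
  have him1 := (Complex.abs_im_le_norm (zwVal z)).trans h1
  have hre2 := (Complex.abs_re_le_norm (evalZeta (omega ^ 5) z)).trans h2
  have him2 := (Complex.abs_im_le_norm (evalZeta (omega ^ 5) z)).trans h2
  rw [zwVal_re] at hre1
  rw [zwVal_im] at him1
  rw [evalZeta_omega5_re] at hre2
  rw [evalZeta_omega5_im] at him2
  have hs : Real.sqrt 2 * Real.sqrt 2 = 2 := Real.mul_self_sqrt zero_le_two
  have hs1 : 1 ≤ Real.sqrt 2 := Real.one_le_sqrt.2 one_le_two
  have hM : 0 ≤ M := (norm_nonneg _).trans h1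
  rw [abs_le] at hre1 him1 hre2 him2 ⊢
  obtain ⟨hre1l, hre1u⟩ := hre1
  obtain ⟨him1l, him1u⟩ := him1
  obtain ⟨hre2l, hre2u⟩ := hre2
  obtain ⟨him2l, him2u⟩ := him2
  fin_cases k
  · change -(2 * M) ≤ (z 0 : ℝ) ∧ (z 0 : ℝ) ≤ 2 * M
    constructor <;> nlinarith
  · change -(2 * M) ≤ (z 1 : ℝ) ∧ (z 1 : ℝ) ≤ 2 * M
    constructor <;> nlinarith
  · change -(2 * M) ≤ (z 2 : ℝ) ∧ (z 2 : ℝ) ≤ 2 * M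
    constructor <;> nlinarith
  · change -(2 * M) ≤ (z 3 : ℝ) ∧ (z 3 : ℝ) ≤ 2 * M
    constructor <;> nlinarith

/-- Integer form: `|zₖ| ≤ 2M` for a natural bound `M`. [folklore] -/
theorem natAbs_le_of_norm_le {z : ZW} {M : ℕ} (h1 : ‖zwVal z‖ ≤ M) (h2 : ‖evalZeta (omega ^ 5) z‖ ≤ M)
    (k : Fin 4) : (z k).natAbs ≤ 2 * M := by
  have h := abs_le_of_norm_le h1 h2 k
  have h' : ((z k).natAbs : ℝ) ≤ 2 * M := by
    rw [Nat.cast_natAbs, Int.cast_abs]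
    exact h
  exact_mod_cast h'

end ZW

end Literature.Computability.QuantumComplexity

end
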